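import Mathlib
import Literature.Computability.AlgebraicComplexity.DepthThreeChasmProofs

/-!
# Crux `ChowBorderDepth3.Depth3Chasm` (stmt-ValiantsHypothesis-5935), line `registered` (birth) —
# stub `stub_chasmExponent`

The p-bounded exponent arithmetic of the depth-three chasm transcription: for all `a, K` there is
`c` such that, whenever the degree `d` and the complexity `s` are p-bounded in the size parameter
`m` (`d, s ≤ m ^ a + a`),

  `2 ^ (K ⌊√(d (log₂ m + 1) (log₂ s + 1))⌋ + K) ≤ (m + 2) ^ (c ⌊√d⌋ + c)`.

Proof: with `ℓ := log₂ (m + 2) + 1` one has `log₂ m + 1 ≤ ℓ`, `log₂ s + 1 ≤ (a + 2) ℓ`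
(`s ≤ m ^ a + a < (m + 2) ^ (a + 1)`), hence
`⌊√(d (log₂ m + 1)(log₂ s + 1))⌋ ≤ (a + 2) ℓ (⌊√d⌋ + 1)`, and `2 ^ ℓ ≤ 2 (m + 2) ≤ (m + 2) ^ 2`;
so `c := 2 K (a + 2) + K` works.  Pure `ℕ` arithmetic on top of the `DepthThree.lg` helper
lemmas of `DepthThreeChasmProofs.lean`.
-/

-- layout Summits/ValiantsHypothesis/ValiantsHypothesis forces the duplicated namespace component
set_option linter.dupNamespace false

namespace Summit.ValiantsHypothesis.ValiantsHypothesis.Theorems.ChowBorderDepth3Depth3Chasm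

open Literature.Computability.AlgebraicComplexity.DepthThree

/-- `2 ^ lg (x + 2) ≤ (x + 2) ^ 2`: indeed
`2 ^ lg (x + 2) = 2 · 2 ^ log₂ (x + 2) ≤ 2 (x + 2) ≤ (x + 2)²` (as `x + 2 ≥ 2`). [folklore] -/
theorem two_pow_lg_add_two_le_sq (x : ℕ) : 2 ^ lg (x + 2) ≤ (x + 2) ^ 2 := by
  have h : 2 ^ Nat.log 2 (x + 2) ≤ x + 2 := Nat.pow_log_le_self 2 (by omega)
  rw [lg, pow_succ, pow_two]
  exact Nat.mul_le_mul h (by omega)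

/-- `s ≤ m ^ a + a` gives `lg s ≤ (a + 2) · lg (m + 2)`. [folklore] -/
theorem lg_le_of_le_pow_add {m a s : ℕ} (hs : s ≤ m ^ a + a) : lg s ≤ (a + 2) * lg (m + 2) := by
  have h1 : lg s ≤ (a + 1) * lg (m + 2) + 1 :=
    (lg_mono (hs.trans ((Nat.le_succ _).trans (pow_add_le_pow m a)))).trans (lg_pow_le _ _)
  have h2 := one_le_lg (m + 2)
  calc lg s ≤ (a + 1) * lg (m + 2) + 1 := h1
    _ ≤ (a + 1) * lg (m + 2) + lg (m + 2) := Nat.add_le_add_left h2 _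
    _ = (a + 2) * lg (m + 2) := by ring

/-- The square-root bookkeeping: for `s ≤ m ^ a + a`,
`⌊√(d · lg m · lg s)⌋ ≤ (a + 2) lg (m + 2) ⌊√d⌋ + (a + 2) lg (m + 2)`. [folklore] -/
theorem sqrt_mul_lg_mul_lg_le {m a d s : ℕ} (hs : s ≤ m ^ a + a) :
    Nat.sqrt (d * lg m * lg s) ≤
      (a + 2) * lg (m + 2) * Nat.sqrt d + (a + 2) * lg (m + 2) := by
  apply le_mul_sqrt_add
  have hm : lg m ≤ lg (m + 2) := lg_mono (Nat.le_add_right m 2)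
  have hs' : lg s ≤ (a + 2) * lg (m + 2) := lg_le_of_le_pow_add hs
  calc Nat.sqrt (d * lg m * lg s) * Nat.sqrt (d * lg m * lg s)
        ≤ d * lg m * lg s := Nat.sqrt_le _
    _ ≤ d * lg (m + 2) * ((a + 2) * lg (m + 2)) := by gcongr
    _ = (a + 2) * lg (m + 2) * lg (m + 2) * d * 1 := by ring
    _ ≤ (a + 2) * lg (m + 2) * lg (m + 2) * d * (a + 2) := Nat.mul_le_mul_left _ (by omega)
    _ = (a + 2) * lg (m + 2) * ((a + 2) * lg (m + 2)) * d := by ring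

/-- **Stub `stub_chasmExponent`** (crux `Depth3Chasm`, stmt-ValiantsHypothesis-5935, line birth):
the p-bounded exponent arithmetic.  For all `a, K` there is `c` (namely `c = 2 K (a + 2) + K`) with
`2 ^ (K ⌊√(d (log₂ m + 1)(log₂ s + 1))⌋ + K) ≤ (m + 2) ^ (c ⌊√d⌋ + c)` whenever `d, s ≤ m ^ a + a`.
[folklore] -/
theorem stub_chasmExponent :
    ∀ a K : ℕ, ∃ c : ℕ, ∀ m d s : ℕ, d ≤ m ^ a + a → s ≤ m ^ a + a →
      2 ^ (K * Nat.sqrt (d * (Nat.log 2 m + 1) * (Nat.log 2 s + 1)) + K) ≤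
        (m + 2) ^ (c * Nat.sqrt d + c) := by
  intro a K
  refine ⟨2 * K * (a + 2) + K, fun m d s _ hs => ?_⟩
  have hX : Nat.sqrt (d * (Nat.log 2 m + 1) * (Nat.log 2 s + 1)) ≤
      (a + 2) * lg (m + 2) * Nat.sqrt d + (a + 2) * lg (m + 2) :=
    sqrt_mul_lg_mul_lg_le hs
  have hE : K * Nat.sqrt (d * (Nat.log 2 m + 1) * (Nat.log 2 s + 1)) + K ≤
      lg (m + 2) * (K * (a + 2) * (Nat.sqrt d + 1)) + K :=
    calc K * Nat.sqrt (d * (Nat.log 2 m + 1) * (Nat.log 2 s + 1)) + K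
          ≤ K * ((a + 2) * lg (m + 2) * Nat.sqrt d + (a + 2) * lg (m + 2)) + K := by gcongr
      _ = lg (m + 2) * (K * (a + 2) * (Nat.sqrt d + 1)) + K := by ring
  have hexp : 2 * (K * (a + 2) * (Nat.sqrt d + 1)) + K ≤
      (2 * K * (a + 2) + K) * Nat.sqrt d + (2 * K * (a + 2) + K) := by
    nlinarith [Nat.zero_le (K * Nat.sqrt d)]
  calc 2 ^ (K * Nat.sqrt (d * (Nat.log 2 m + 1) * (Nat.log 2 s + 1)) + K)
        ≤ 2 ^ (lg (m + 2) * (K * (a + 2) * (Nat.sqrt d + 1)) + K) :=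
          Nat.pow_le_pow_right Nat.two_pos hE
    _ = (2 ^ lg (m + 2)) ^ (K * (a + 2) * (Nat.sqrt d + 1)) * 2 ^ K := by rw [pow_add, pow_mul]
    _ ≤ ((m + 2) ^ 2) ^ (K * (a + 2) * (Nat.sqrt d + 1)) * (m + 2) ^ K :=
          Nat.mul_le_mul (Nat.pow_le_pow_left (two_pow_lg_add_two_le_sq m) _)
            (Nat.pow_le_pow_left (by omega) _)
    _ = (m + 2) ^ (2 * (K * (a + 2) * (Nat.sqrt d + 1)) + K) := by rw [← pow_mul, ← pow_add]
    _ ≤ (m + 2) ^ ((2 * K * (a + 2) + K) * Nat.sqrt d + (2 * K * (a + 2) + K)) :=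
          Nat.pow_le_pow_right (by omega) hexp

end Summit.ValiantsHypothesis.ValiantsHypothesis.Theorems.ChowBorderDepth3Depth3Chasm
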